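import Summits.HodgeConjecture.CorCM.GaloisOddPrimeUniqueInvolutionOdd
import HarnessLib

/-!
# THE FIVE SHAPES: a GOOD Galois CM field of degree `2ⁿ·p` has `Gal(K/ℚ) = ⟨u⟩ ⋊ S` with `S = ⟨x⟩ ≅ C_{2ⁿ}` acting by `u ↦ uʳ`, or
# `S = ⟨a, x⟩ ≅ Q_{2ⁿ}` acting through `{±1}` in one of three ways (`Q × C_p`, dicyclic, quaternion kernel)

COR-CM (cell `pub-hodgecm2`), binder seat b04 (gen 38), count-neutral own lane «Galois-CM-type classification».  KERNEL ONLY: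
theorems; no definition, no named fact, no `sorry`.  `HC_CM` is neither used nor claimed.

By `CorCM/GaloisOddPrimeUniqueInvolution` a GOOD Galois CM field `K` of degree `2ⁿ·M`, `M ≠ 1` odd, `n ≥ 5` (gen 33's size condition
for the primes `< 31` dividing `M`) has `M = p` prime and `Gal(K/ℚ) = P ⋊ S`, `P = ⟨u⟩ ≅ C_p` normal, `S` a Sylow `2`-subgroup, cyclic
or generalised quaternion.  Since `Aut(C_p)` is abelian, commutators of `S` centralise `u`, and an element whose square centralises
`u` acts by `u ↦ u^{±1}` (§1).  Hence (§2):
* `S = ⟨x⟩` cyclic of order `2ⁿ`: `x u x⁻¹ = uʳ` — **shape C(r)** (`r ≡ 1`: `K` cyclic; `r` of `2`-power order `≥ 2`: the metacyclic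
  families of gens 25–27);
* `S = ⟨a, x⟩ ≅ Q_{2ⁿ}` (`x a = a⁻¹ x`, `x² = a^{2ⁿ⁻²}`): `[a, x] = a²` centralises `u`, so `a` and `x` act by `±1`, and after
  replacing `x` by `a x` if both invert: **shape Q×** (`a, x` centralise `u`: `Q_{2ⁿ} × C_p`), **shape Dic** (`a` centralises, `x`
  inverts: the dicyclic group `Dic_{2ⁿ⁻² p}`, GOOD by gen 20), **shape QK** (`a` inverts, `x` centralises: quaternion kernel
  `⟨a², x⟩ ≅ Q_{2ⁿ⁻¹}`).
So the classification of GOOD Galois CM fields of large degree is reduced to the ARITHMETIC of the shapes C(r) (`r ≠ 1`), Q× and QK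
(gens 25–30: norm pairs, residue conditions; e.g. `C_p ⋊ C₈` and `Q₈ × C_p` are GOOD iff `ℤ/p` has no `μ₄`-norm pair).

## References

* [Shimura1998] G. Shimura, *Abelian Varieties with Complex Multiplication and Modular Functions*, §8.2 Prop. 26, §32.10.
* [Dodson1984] B. Dodson, *The structure of Galois groups of CM-fields*, Trans. AMS 283 (1984), §3.1.1, §4.1, §5.
* [Rotman1995] J. J. Rotman, *An Introduction to the Theory of Groups*, 4th ed., GTM 148, Thm. 4.12, Thm. 5.46, Thm. 7.41.
-/

noncomputable section

open CategoryTheory CategoryTheory.Limits NumberField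
open scoped BigOperators

namespace Summit.HodgeConjecture.CorCM.GaloisModels

open Literature.NumberTheory.ComplexMultiplication Literature.AlgebraicGeometry.HodgeTheory
open Literature.AlgebraicGeometry.Motives (AbelianVariety CMType)
open Literature.AlgebraicGeometry.Pohlmann1968 Summit.HodgeConjecture.CorCM.GaloisRank

/-! ## §1 Group lemmas: automorphisms of `C_p` commute, and square-trivial ones are `±1` -/

section Group

variable {G : Type*} [Group G]

/-- `g u g⁻¹ = uʳ` ⟹ `g uᵏ g⁻¹ = u^{rk}`. [folklore] -/
theorem conj_pow_eq_pow_mul {g u : G} {r : ℕ} (h : g * u * g⁻¹ = u ^ r) (k : ℕ) : g * u ^ k * g⁻¹ = u ^ (r * k) := by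
  rw [← conj_pow, h, ← pow_mul]

/-- A conjugate of `u` by an element normalising the finite cyclic group `⟨u⟩` is a natural power of `u`. [folklore] -/
theorem exists_conj_eq_pow [Finite G] {u g : G} (h : g * u * g⁻¹ ∈ Subgroup.zpowers u) : ∃ r : ℕ, g * u * g⁻¹ = u ^ r := by
  obtain ⟨r, hr⟩ := (Submonoid.mem_powers_iff _ _).1 (mem_powers_iff_mem_zpowers.2 h)
  exact ⟨r, hr.symm⟩

/-- **Commutators centralise `u`**: if `g₁^{±1}`, `g₂^{±1}` conjugate `u` to powers of `u`, then `[g₁, g₂] = g₁g₂g₁⁻¹g₂⁻¹` commutes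
with `u` (`Aut ⟨u⟩` is abelian). [folklore] -/
theorem commutator_mul_eq_mul {u g₁ g₂ : G} {r₁ r₂ s₁ s₂ : ℕ} (h₁ : g₁ * u * g₁⁻¹ = u ^ r₁) (h₂ : g₂ * u * g₂⁻¹ = u ^ r₂)
    (k₁ : g₁⁻¹ * u * g₁ = u ^ s₁) (k₂ : g₂⁻¹ * u * g₂ = u ^ s₂) :
    (g₁ * g₂ * g₁⁻¹ * g₂⁻¹) * u * (g₁ * g₂ * g₁⁻¹ * g₂⁻¹)⁻¹ = u := by
  have k₁' : g₁⁻¹ * u * g₁⁻¹⁻¹ = u ^ s₁ := by rw [inv_inv]; exact k₁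
  have k₂' : g₂⁻¹ * u * g₂⁻¹⁻¹ = u ^ s₂ := by rw [inv_inv]; exact k₂
  -- `u^{r₂ s₂} = u`, `u^{r₁ s₁} = u`
  have e₂ : u ^ (r₂ * s₂) = u := by
    rw [← conj_pow_eq_pow_mul h₂, ← k₂', inv_inv]; group
  have e₁ : u ^ (r₁ * s₁) = u := by
    rw [← conj_pow_eq_pow_mul h₁, ← k₁', inv_inv]; group
  calc (g₁ * g₂ * g₁⁻¹ * g₂⁻¹) * u * (g₁ * g₂ * g₁⁻¹ * g₂⁻¹)⁻¹
      = g₁ * (g₂ * (g₁⁻¹ * (g₂⁻¹ * u * g₂⁻¹⁻¹) * g₁⁻¹⁻¹) * g₂⁻¹) * g₁⁻¹ := by group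
    _ = u ^ (r₁ * (r₂ * (s₁ * s₂))) := by
        rw [k₂', conj_pow_eq_pow_mul k₁', conj_pow_eq_pow_mul h₂, conj_pow_eq_pow_mul h₁]
    _ = (u ^ (r₁ * s₁)) ^ (r₂ * s₂) := by rw [← pow_mul]; ring_nf
    _ = u := by rw [e₁, e₂]

/-- **Square-trivial ⟹ `±1`**: `u` of prime order `p`, `g u g⁻¹ = uʳ` and `g²` centralises `u` ⟹ `g u g⁻¹ ∈ {u, u⁻¹}`.
[folklore] -/
theorem conj_eq_self_or_inv {u g : G} {p r : ℕ} [hp : Fact p.Prime] (hu : orderOf u = p) (h : g * u * g⁻¹ = u ^ r)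
    (h2 : g * g * u * (g * g)⁻¹ = u) : g * u * g⁻¹ = u ∨ g * u * g⁻¹ = u⁻¹ := by
  have hrr : u ^ (r * r) = u ^ 1 := by
    rw [pow_one, ← conj_pow_eq_pow_mul h r, ← h]
    calc g * (g * u * g⁻¹) * g⁻¹ = g * g * u * (g * g)⁻¹ := by group
      _ = u := h2
  rw [pow_eq_pow_iff_modEq, hu] at hrr
  have hz : ((r : ZMod p)) ^ 2 = 1 := by
    have := (ZMod.natCast_eq_natCast_iff' (r * r) 1 p).2 hrr
    rw [Nat.cast_mul, Nat.cast_one] at this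
    rw [pow_two]
    exact this
  rcases sq_eq_one_iff.1 hz with h1 | h1
  · left
    rw [h, ← pow_one u, ← pow_mul, one_mul, pow_eq_pow_iff_modEq, hu]
    exact (ZMod.natCast_eq_natCast_iff' r 1 p).1 (by rw [h1, Nat.cast_one])
  · right
    have hr : r ≡ p - 1 [MOD p] := by
      refine (ZMod.natCast_eq_natCast_iff' r (p - 1) p).1 ?_
      rw [h1, Nat.cast_sub hp.out.one_le, Nat.cast_one, ZMod.natCast_self, zero_sub]
    have hup : u ^ p = 1 := by rw [← hu]; exact pow_orderOf_eq_one u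
    rw [h, (pow_eq_pow_iff_modEq.2 (by rw [hu]; exact hr) : u ^ r = u ^ (p - 1))]
    exact eq_inv_of_mul_eq_one_left (by rw [← pow_succ, Nat.sub_add_cancel hp.out.one_le, hup])

/-- If `g` centralises `u`, so does every power of `g`. [folklore] -/
theorem pow_mul_eq_of_mul_eq {u g : G} (h : g * u * g⁻¹ = u) (k : ℕ) : g ^ k * u * (g ^ k)⁻¹ = u := by
  have hc : Commute g u := by
    change g * u = u * g
    calc g * u = g * u * g⁻¹ * g := by group
      _ = u * g := by rw [h]
  rw [(hc.pow_left k).eq, mul_inv_cancel_right]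

end Group

/-! ## §2 The shapes -/

variable {K : Type} [Field K] [NumberField K] [IsCMField K] [IsGalois ℚ K]

/-- **SHAPE C(r): cyclic Sylow `2`-subgroup.**  Under the hypotheses of `exists_cyclic_odd_complement_sylow_two'`, if a Sylow `2`-subgroup
`S` is cyclic then `Gal(K/ℚ) = ⟨u⟩ ⋊ ⟨x⟩` with `u` of order `M` (prime) generating a normal subgroup, `x` of order `2ⁿ` generating `S`,
every element `uʲ xⁱ`, and `x u x⁻¹ = uʳ` for some `r`. [cite: Shimura1998, §8.2 Prop. 26 and §32.10] [cite: Dodson1984, §5]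
[cite: Rotman1995, Thm. 4.12 and Thm. 7.41] -/
theorem shape_of_isCyclic_sylow {n M : ℕ} (hdeg : Module.finrank ℚ K = 2 ^ n * M) (hM : Odd M) (hn : 5 ≤ n) (hM1 : M ≠ 1)
    (hsize : ∀ p a m : ℕ, p.Prime → p ≠ 2 → p < 31 → Module.finrank ℚ K = 2 * p ^ a * m → ¬ p ∣ m → 1 ≤ a →
      16 ≤ m ∧ (p = 3 ∨ 8 * p ≤ 2 ^ (m / 4)))
    (hgood : ∀ (Φ : CMType K) (φ : K →+* ℂ), IsPrimitive (ℂ ≃+* ℂ) Φ.1 φ → IsNondegenerate Φ) [Fact (Nat.Prime 2)]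
    (S : Sylow 2 (K ≃ₐ[ℚ] K)) (hS : IsCyclic (S : Subgroup (K ≃ₐ[ℚ] K))) :
    M.Prime ∧ ∃ u x : K ≃ₐ[ℚ] K, orderOf u = M ∧ (Subgroup.zpowers u).Normal ∧ orderOf x = 2 ^ n ∧
      Subgroup.zpowers x = (S : Subgroup (K ≃ₐ[ℚ] K)) ∧ (∀ g : K ≃ₐ[ℚ] K, ∃ j i : ℕ, g = u ^ j * x ^ i) ∧
      ∃ r : ℕ, x * u * x⁻¹ = u ^ r := by
  classical
  obtain ⟨P, hPn, hcardP, hMp, hPcyc, -, hall⟩ := exists_cyclic_odd_complement_sylow_two' hdeg hM hn hM1 hsize hgood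
  obtain ⟨hPS, hcardS, -⟩ := hall S
  haveI := hPn
  -- generators
  obtain ⟨uP, huP⟩ := IsCyclic.exists_generator (α := P)
  obtain ⟨xS, hxS⟩ := IsCyclic.exists_generator (α := (S : Subgroup (K ≃ₐ[ℚ] K)))
  set u : K ≃ₐ[ℚ] K := (uP : K ≃ₐ[ℚ] K) with hu
  set x : K ≃ₐ[ℚ] K := (xS : K ≃ₐ[ℚ] K) with hx
  have hou : orderOf u = M := by rw [hu, Subgroup.orderOf_coe, orderOf_eq_card_of_forall_mem_zpowers huP, hcardP]
  have hox : orderOf x = 2 ^ n := by rw [hx, Subgroup.orderOf_coe, orderOf_eq_card_of_forall_mem_zpowers hxS, hcardS]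
  have hPu : Subgroup.zpowers u = P := by
    refine Subgroup.eq_of_le_of_card_ge ((Subgroup.zpowers_le).2 uP.2) ?_
    rw [Nat.card_zpowers, hou, hcardP]
  have hSx : Subgroup.zpowers x = (S : Subgroup (K ≃ₐ[ℚ] K)) := by
    refine Subgroup.eq_of_le_of_card_ge ((Subgroup.zpowers_le).2 xS.2) ?_
    rw [Nat.card_zpowers, hox, hcardS]
  refine ⟨hMp, u, x, hou, by rw [hPu]; exact hPn, hox, hSx, fun g => ?_, ?_⟩
  · obtain ⟨⟨q, s⟩, hqs, -⟩ := Subgroup.isComplement'_def.1 hPS |>.existsUnique g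
    have hq : (q : K ≃ₐ[ℚ] K) ∈ Subgroup.zpowers u := by rw [hPu]; exact q.2
    have hs : (s : K ≃ₐ[ℚ] K) ∈ Subgroup.zpowers x := by rw [hSx]; exact s.2
    obtain ⟨j, hj⟩ := (Submonoid.mem_powers_iff _ _).1 (mem_powers_iff_mem_zpowers.2 hq)
    obtain ⟨i, hi⟩ := (Submonoid.mem_powers_iff _ _).1 (mem_powers_iff_mem_zpowers.2 hs)
    exact ⟨j, i, by rw [hj, hi]; exact hqs.symm⟩
  · have hmem : x * u * x⁻¹ ∈ Subgroup.zpowers u := by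
      rw [hPu]
      exact hPn.conj_mem u (by rw [← hPu]; exact Subgroup.mem_zpowers u) x
    exact exists_conj_eq_pow hmem

/-- **SHAPES Q×, Dic, QK: generalised quaternion Sylow `2`-subgroup.**  Under the hypotheses of
`exists_cyclic_odd_complement_sylow_two'`, if a Sylow `2`-subgroup `S ≃ Q_{2ⁿ}` then `Gal(K/ℚ) = ⟨u⟩ ⋊ ⟨a, x⟩` with `u` of order `M`
(prime) generating a normal subgroup, `a` of order `2ⁿ⁻¹`, `x ∉ ⟨a⟩`, `x a = a⁻¹ x`, `x² = a^{2ⁿ⁻²}`, every element `uʲ aⁱ` or `uʲ x aⁱ`,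
and the action is ONE OF: `a`, `x` centralise `u` (shape Q×); `a` centralises and `x` inverts `u` (shape Dic); `a` inverts and `x`
centralises `u` (shape QK). [cite: Shimura1998, §8.2 Prop. 26 and §32.10] [cite: Dodson1984, §5] [cite: Rotman1995, Thm. 4.12, Thm. 5.46 and Thm. 7.41] -/
theorem shape_of_quaternion_sylow {n M : ℕ} (hdeg : Module.finrank ℚ K = 2 ^ n * M) (hM : Odd M) (hn : 5 ≤ n) (hM1 : M ≠ 1)
    (hsize : ∀ p a m : ℕ, p.Prime → p ≠ 2 → p < 31 → Module.finrank ℚ K = 2 * p ^ a * m → ¬ p ∣ m → 1 ≤ a →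
      16 ≤ m ∧ (p = 3 ∨ 8 * p ≤ 2 ^ (m / 4)))
    (hgood : ∀ (Φ : CMType K) (φ : K →+* ℂ), IsPrimitive (ℂ ≃+* ℂ) Φ.1 φ → IsNondegenerate Φ) [Fact (Nat.Prime 2)]
    (S : Sylow 2 (K ≃ₐ[ℚ] K)) (f : (S : Subgroup (K ≃ₐ[ℚ] K)) ≃* QuaternionGroup (2 ^ (n - 2))) :
    M.Prime ∧ ∃ u a x : K ≃ₐ[ℚ] K, orderOf u = M ∧ (Subgroup.zpowers u).Normal ∧ orderOf a = 2 ^ (n - 1) ∧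
      a ∈ (S : Subgroup (K ≃ₐ[ℚ] K)) ∧ x ∈ (S : Subgroup (K ≃ₐ[ℚ] K)) ∧ x ∉ Subgroup.zpowers a ∧ x * a = a⁻¹ * x ∧
      x * x = a ^ 2 ^ (n - 2) ∧ (∀ g : K ≃ₐ[ℚ] K, ∃ j i : ℕ, g = u ^ j * a ^ i ∨ g = u ^ j * (x * a ^ i)) ∧
      ((a * u * a⁻¹ = u ∧ x * u * x⁻¹ = u) ∨ (a * u * a⁻¹ = u ∧ x * u * x⁻¹ = u⁻¹) ∨ (a * u * a⁻¹ = u⁻¹ ∧ x * u * x⁻¹ = u)) := by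
  classical
  haveI : NeZero (2 ^ (n - 2)) := ⟨by positivity⟩
  haveI : Fact M.Prime := ⟨(exists_cyclic_odd_complement_sylow_two' hdeg hM hn hM1 hsize hgood).choose_spec.2.2.1⟩
  obtain ⟨P, hPn, hcardP, hMp, hPcyc, -, hall⟩ := exists_cyclic_odd_complement_sylow_two' hdeg hM hn hM1 hsize hgood
  obtain ⟨hPS, hcardS, -⟩ := hall S
  haveI := hPn
  obtain ⟨uP, huP⟩ := IsCyclic.exists_generator (α := P)
  set u : K ≃ₐ[ℚ] K := (uP : K ≃ₐ[ℚ] K) with hu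
  have hou : orderOf u = M := by rw [hu, Subgroup.orderOf_coe, orderOf_eq_card_of_forall_mem_zpowers huP, hcardP]
  have hPu : Subgroup.zpowers u = P := by
    refine Subgroup.eq_of_le_of_card_ge ((Subgroup.zpowers_le).2 uP.2) ?_
    rw [Nat.card_zpowers, hou, hcardP]
  have hconj : ∀ g : K ≃ₐ[ℚ] K, ∃ r : ℕ, g * u * g⁻¹ = u ^ r := fun g => by
    refine exists_conj_eq_pow ?_
    rw [hPu]
    exact hPn.conj_mem u (by rw [← hPu]; exact Subgroup.mem_zpowers u) g
  -- quaternion data on `S`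
  obtain ⟨a, x₀, haS, hx₀S, hform₀, hx₀a, hx₀a', hx₀x₀, -⟩ := exists_index_two_data_of_mulEquiv_quaternionGroup _ f
  -- `orderOf a = 2^(n-1)`: `⟨a⟩` has index `2` in `S`
  have hoa : orderOf a = 2 ^ (n - 1) := by
    have hle : Nat.card (S : Subgroup (K ≃ₐ[ℚ] K)) ≤ 2 * orderOf a := by
      have hAS : Subgroup.zpowers a ≤ (S : Subgroup (K ≃ₐ[ℚ] K)) := (Subgroup.zpowers_le).2 haS
      let φ : Bool × Subgroup.zpowers a → (S : Subgroup (K ≃ₐ[ℚ] K)) := fun bt =>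
        if bt.1 then ⟨x₀ * bt.2, (S : Subgroup (K ≃ₐ[ℚ] K)).mul_mem hx₀S (hAS bt.2.2)⟩ else ⟨bt.2, hAS bt.2.2⟩
      have hφ : Function.Surjective φ := by
        intro s
        obtain ⟨i, hi⟩ := hform₀ s s.2
        rcases hi with hi | hi
        · exact ⟨(false, ⟨a ^ i, Subgroup.npow_mem_zpowers a i⟩), Subtype.ext (by simp [φ, hi])⟩
        · exact ⟨(true, ⟨a ^ i, Subgroup.npow_mem_zpowers a i⟩), Subtype.ext (by simp [φ, hi])⟩
      calc Nat.card (S : Subgroup (K ≃ₐ[ℚ] K)) ≤ Nat.card (Bool × Subgroup.zpowers a) := Nat.card_le_card_of_surjective φ hφ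
        _ = 2 * orderOf a := by rw [Nat.card_prod, Nat.card_zpowers, Nat.card_eq_fintype_card, Fintype.card_bool]
    have hdvd : orderOf a ∣ 2 ^ n := by
      rw [← hcardS, ← Subgroup.orderOf_mk a haS]
      exact orderOf_dvd_natCard (⟨a, haS⟩ : (S : Subgroup (K ≃ₐ[ℚ] K)))
    obtain ⟨j, hjn, hj⟩ := (Nat.dvd_prime_pow Nat.prime_two).1 hdvd
    have hne : orderOf a ≠ 2 ^ n := fun h => by
      apply hx₀a
      have heq : Subgroup.zpowers a = (S : Subgroup (K ≃ₐ[ℚ] K)) :=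
        Subgroup.eq_of_le_of_card_ge ((Subgroup.zpowers_le).2 haS) (by rw [Nat.card_zpowers, h, hcardS])
      rw [heq]
      exact hx₀S
    rw [hcardS] at hle
    rw [hj] at hle hne ⊢
    have hjn' : j ≠ n := fun h => hne (by rw [h])
    have hj2 : n ≤ j + 1 := by
      by_contra hlt
      have h1 : 2 * 2 ^ j ≤ 2 ^ (n - 1) := by
        rw [← pow_succ']
        exact Nat.pow_le_pow_right two_pos (by omega)
      have h2 : 2 ^ (n - 1) < 2 ^ n := Nat.pow_lt_pow_right (by norm_num) (by omega)
      omega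
    congr 1
    omega
  -- commutator `[a, x₀] = a²`, so `a²` and `x₀² = a^{2ⁿ⁻²}` centralise `u`
  obtain ⟨ra, hra⟩ := hconj a
  obtain ⟨sa, hsa⟩ := hconj a⁻¹
  rw [inv_inv] at hsa
  obtain ⟨rx, hrx⟩ := hconj x₀
  obtain ⟨sx, hsx⟩ := hconj x₀⁻¹
  rw [inv_inv] at hsx
  have hxax : x₀ * a * x₀⁻¹ = a⁻¹ := by rw [hx₀a', mul_inv_cancel_right]
  have hxainv : x₀ * a⁻¹ * x₀⁻¹ = a := by
    calc x₀ * a⁻¹ * x₀⁻¹ = (x₀ * a * x₀⁻¹)⁻¹ := by group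
      _ = a := by rw [hxax, inv_inv]
  have hcomm : a * x₀ * a⁻¹ * x₀⁻¹ = a * a := by
    calc a * x₀ * a⁻¹ * x₀⁻¹ = a * (x₀ * a⁻¹ * x₀⁻¹) := by group
      _ = a * a := by rw [hxainv]
  have haa : a * a * u * (a * a)⁻¹ = u := by
    rw [← hcomm]
    exact commutator_mul_eq_mul hra hrx hsa hsx
  have hn3 : 2 ^ (n - 2) = 2 * 2 ^ (n - 3) := by
    obtain ⟨n', rfl⟩ := Nat.exists_eq_add_of_le hn
    rw [show 5 + n' - 2 = (5 + n' - 3) + 1 by omega, pow_succ, mul_comm]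
  have hxx : x₀ * x₀ * u * (x₀ * x₀)⁻¹ = u := by
    rw [hx₀x₀, hn3, pow_mul, pow_two]
    exact pow_mul_eq_of_mul_eq haa _
  have ha := conj_eq_self_or_inv (p := M) hou hra haa
  have hx := conj_eq_self_or_inv (p := M) hou hrx hxx
  -- normal form `g = uʲ s`, `s ∈ S = {aⁱ, x₀ aⁱ}`
  have hform : ∀ g : K ≃ₐ[ℚ] K, ∃ j i : ℕ, g = u ^ j * a ^ i ∨ g = u ^ j * (x₀ * a ^ i) := fun g => by
    obtain ⟨⟨q, s⟩, hqs, -⟩ := Subgroup.isComplement'_def.1 hPS |>.existsUnique g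
    have hq : (q : K ≃ₐ[ℚ] K) ∈ Subgroup.zpowers u := by rw [hPu]; exact q.2
    obtain ⟨j, hj⟩ := (Submonoid.mem_powers_iff _ _).1 (mem_powers_iff_mem_zpowers.2 hq)
    obtain ⟨i, hi⟩ := hform₀ s s.2
    refine ⟨j, i, ?_⟩
    rcases hi with hi | hi
    · left; rw [hj, ← hi]; exact hqs.symm
    · right; rw [hj, ← hi]; exact hqs.symm
  refine ⟨hMp, ?_⟩
  -- the case where both `a` and `x₀` invert `u`: replace `x₀` by `a x₀`
  by_cases hboth : a * u * a⁻¹ = u⁻¹ ∧ x₀ * u * x₀⁻¹ = u⁻¹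
  · refine ⟨u, a, a * x₀, hou, by rw [hPu]; exact hPn, hoa, haS, (S : Subgroup (K ≃ₐ[ℚ] K)).mul_mem haS hx₀S,
      fun h => hx₀a ?_, ?_, ?_, fun g => ?_, Or.inr (Or.inr ⟨hboth.1, ?_⟩)⟩
    · have : x₀ = a⁻¹ * (a * x₀) := by rw [inv_mul_cancel_left]
      rw [this]
      exact (Subgroup.zpowers a).mul_mem ((Subgroup.zpowers a).inv_mem (Subgroup.mem_zpowers a)) h
    · rw [mul_assoc, hx₀a', ← mul_assoc, mul_inv_cancel, one_mul, ← mul_assoc, inv_mul_cancel, one_mul]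
    · rw [← hx₀x₀]
      calc a * x₀ * (a * x₀) = a * (x₀ * a) * x₀ := by group
        _ = x₀ * x₀ := by rw [hx₀a', ← mul_assoc, mul_inv_cancel, one_mul]
    · obtain ⟨j, i, hg⟩ := hform g
      rcases hg with hg | hg
      · exact ⟨j, i, Or.inl hg⟩
      · refine ⟨j, i + 1, Or.inr ?_⟩
        rw [hg, pow_succ']
        congr 1
        calc x₀ * a ^ i = a * x₀ * a * a ^ i := by rw [mul_assoc a x₀ a, hx₀a', mul_inv_cancel_left]
          _ = a * x₀ * (a * a ^ i) := by group
    · calc a * x₀ * u * (a * x₀)⁻¹ = a * (x₀ * u * x₀⁻¹) * a⁻¹ := by group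
        _ = (a * u * a⁻¹)⁻¹ := by rw [hboth.2]; group
        _ = u := by rw [hboth.1, inv_inv]
  · refine ⟨u, a, x₀, hou, by rw [hPu]; exact hPn, hoa, haS, hx₀S, hx₀a, hx₀a', hx₀x₀, hform, ?_⟩
    rcases ha with ha | ha <;> rcases hx with hx | hx
    · exact Or.inl ⟨ha, hx⟩
    · exact Or.inr (Or.inl ⟨ha, hx⟩)
    · exact Or.inr (Or.inr ⟨ha, hx⟩)
    · exact absurd ⟨ha, hx⟩ hboth

end Summit.HodgeConjecture.CorCM.GaloisModels

end
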